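import Literature.MathematicalPhysics.QuantumFieldTheory.Balaban1983to89.B13Lemma3TorusTerms
import Literature.MathematicalPhysics.QuantumFieldTheory.Balaban1983to89.B13CauchyDecay

/-!
# `Balaban1983to89.B13Lemma3TorusCauchy` — T. Bałaban, *Renormalization group approach to lattice gauge field theories.
II. Cluster expansions*, Commun. Math. Phys. **116** (1988) 1–22 [Balaban1988RG2Cluster]: on the two-scale TORUS model
(the papers' periodic carrier, [I] p. 251), the hypothesis «(2.26) FOR EVERY TERM» of Lemma 3
(`B13Lemma3TorusTerms.bound238_torus_of_226`) and of the §2 chain (`B13Lemma3TorusTerms.deliverables_torus_termwise_of_226`)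
REDUCED, by the iterated Cauchy estimate `B13CauchyDecay`, to: the (2.14)-form of the terms, separate analyticity in the
parameters σ(Δ), τ(Y), and the Gaussian sup bound of (2.15)–(2.25) — the torus twin of `B13Lemma3WindowCauchy`

statement-level skeleton of published theorems with citation tags; proofs where landed; nothing here is a claim about the Yang–Mills mass gap

PDF held: `paper:balaban1988-cmp116-rg-ii-cluster` (journal page = PDF page + 0); pp. 15–17 (quoted in `B13Term214`,
`B13CauchyDecay`, `B13Lemma3TorusTerms`).

CITATION HEADER (verbatim, p. 15 [PDF 15] and p. 17 [PDF 17]).  *"To get a bound for H(Z) we consider a term in the sum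
over 𝐃, P. This term can be written in the following form:"* (2.14) = `Π_{Δ⊂Z∖Z′₀}∫₀¹ds(Δ)(1/2πi)∮dσ(Δ)/(σ(Δ) − s(Δ))²
Π_{Y∈𝐃}∫₀¹dt(Y)(1/2πi)∮dτ(Y)/(τ(Y) − t(Y))² [three Gaussian lines]`; *"We consider it as an analytic function of (𝐔, 𝐉)
…, and of the complex parameters σ(Z), τ. … The first estimate is"* (2.15) = `|(2.14)| ≦ exp(−(κ₁ − 1)(LM)⁻⁴|Z∖Z′₀|)
Π_{Y∈𝐃}(2/|τ(Y)|) · [moduli / real parts of the three lines]`; p. 17: *"This ends the estimate of the expression (2.14).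
Gathering together all the bounds we get"* (2.26) = `|(2.14)| ≦ exp(−(κ₁ − 1)(LM)⁻⁴|Z∖Z′₀|)[Π_{Y∈𝐃} 2E₀ε₁C₁α₄⁻¹M^q
e^{C₂κ₁}e^{−(1−3δ)κd_k(Y)}] exp(−½γ₂(ε₁²/g_k²)|P|) exp O(1)α₅|Z|`; *"To get a bound for H(Z) we have to perform the
resummation of the terms (2.14) over 𝐃, P and Z₀. … To bound H(Z) we use the estimate (2.26) for terms of these sums"*.
The carrier: [I] = CMP 109 p. 251 *"T_η = {x ∈ ηℤ^d : −L_μ ≤ x_μ < L_μ, μ = 1, …, d}"* with periodic boundary conditions.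

WHAT IS REPRODUCED (unit `lit-balaban-r10` gen 14, B13 fold owner; SKELETON rows `B13.Eq2.26`, `B13.Eq2.15`,
`B13.Eq2.14`, `B13.Lem3` of `HOME/lit-balaban-r10/ROWS-B13.md`, HOME = `run/shared/lean/pub/lit-balaban/`; kind
«model-instance joiner», one theorem).  **`h226_torus_of_cauchy`**: on the torus model of `B13Lemma3Torus` /
`B13Lemma3TorusTerms` (terms `t = (𝐃, P)` of `H(Z)`, weights `weight L M c Z a t = exp(−(κ₁−1)·#blocks(Z∖Z′₀))·
Π_{Y∈𝐃}(α₆ε₂e^{−(1−3δ)κd_k(Y)})·e^{−½a|P|}`, `Z′₀ = tclosure L N′ Z₀`), IF every term `T Z t φ` is the generic term (2.14)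
`B13Term214.term214 r (lZ Z t) (lD t) (Ψ Z t φ) 0 0` — σ-parameters an enumeration of the blocks of `Z∖Z′₀`, τ-parameters
an enumeration of `𝐃`, base points `s = 0`, `t = 0` — with `Ψ Z t φ` separately holomorphic in `σ` on an open
`Uσ ⊇ {|σ| ≤ e^{κ₁}}` (`κ₁ ≥ 1`) and in `τ` on an open `Uτ ⊇ {|τ| ≤ |τ(Y)|}`, `|τ(Y)| = (invTau c (d_k Y))⁻¹` ((2.18),
`0 < invTau ≤ ½`, `d_k` = the torus tree length of `tsys d (L·N′)`), and the SUP BOUND `‖Ψ Z t φ σ τ‖ ≤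
e^{−½a|P|}·e^{a₅·|Z|}` on the two closed polydiscs (the Gaussian estimate (2.15)–(2.25) of the last three lines of (2.14) —
BY ASSERTION in print, rows B13.Eq2.15–2.25; a hypothesis; supplied from the primitive objects by
`B13Lemma3TorusPrimitive`), THEN (2.26) holds for every term in the exact spelling of the hypothesis `h226` of
`B13Lemma3TorusTerms.hrep_of_termwise` / `bound238_torus_of_226` / `deliverables_torus_termwise_of_226`:
`‖T Z t φ‖ ≤ weight L M c Z a t · exp(a₅·|Z|)`.  Proof = `B13CauchyDecay.norm_term214_le_226` +
`B13CauchyDecay.two_mul_invTau_eq` (`2/|τ(Y)| = α₆ε₂e^{−(1−3δ)κd_k(Y)}`, `α₆ ≠ 0`) + `|lZ| = #blocks(Z∖Z′₀)`.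

HONEST SCOPE.  A pure joiner: nothing analytic is proved here beyond what `B13CauchyDecay` proves (the Cauchy factors);
the (2.14)-form of the terms, their separate analyticity and the Gaussian sup bound are hypotheses; the torus model's
readings (over-counted term set, endpoint reading of Z₀ — HOME GAPS G-B13-P12-01) are those of `B13Lemma3TorusTerms`.
With this file the torus-model §2 chain `deliverables_torus_termwise_of_226` has, upstream of the resummation, exactly
these inputs left by assertion: (2.15)–(2.25) (the sup bound), the representation of H(Z) by (2.14)-terms ((2.9)/(2.14)),
the log Z^{(k)} half, (I.1.7), analyticity in (U, J), gauge invariance — as the window model since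
`B13Lemma3WindowCauchy`.  No `sorry`, no definition, no new named fact (D-0026).
-/

namespace Literature.MathematicalPhysics.QuantumFieldTheory.Balaban1983to89.B13Lemma3TorusCauchy

open Metric Set
open Literature.MathematicalPhysics.QuantumFieldTheory.Balaban1983to89
open Literature.MathematicalPhysics.QuantumFieldTheory.Balaban1983to89.TreeLengthTorus (TPt TDom tsys)
open Literature.MathematicalPhysics.QuantumFieldTheory.Balaban1983to89.TreeLengthTorusTransfer (tclosure)
open Literature.MathematicalPhysics.QuantumFieldTheory.Balaban1983to89.B13Lemma3TorusData (TBond)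
open Literature.MathematicalPhysics.QuantumFieldTheory.Balaban1983to89.B13Lemma3Torus (TwoTorusStep)
open Literature.MathematicalPhysics.QuantumFieldTheory.Balaban1983to89.B13Lemma3TorusTerms (terms weight Z0)
open Literature.MathematicalPhysics.QuantumFieldTheory.Balaban1983to89.B13Term214 (term214 SepHolOn)
open Literature.MathematicalPhysics.QuantumFieldTheory.Balaban1983to89.B13Bound143 (invTau)
open Literature.MathematicalPhysics.QuantumFieldTheory.Balaban1983to89.B13CauchyDecay
  (norm_term214_le_226 two_mul_invTau_eq)

noncomputable section

variable {d L N' : ℕ} [NeZero L] [NeZero N'] {M : ℕ} [NeZero M]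

open Classical in
/-- **(2.26) FOR EVERY TERM from the Cauchy mechanism + the Gaussian sup bound** (torus model).  Suppose every term
`T Z t φ`, `t = (𝐃, P)`, of the activity `H(Z)` is realized as the generic term (2.14) `B13Term214.term214 r lZ lD Ψ 0 0`
with σ-parameters `lZ Z t` = an enumeration of the blocks of `Z∖Z′₀` (`Z.1 ∖ tclosure L N′ (Z0 M t)`, as in
`B13Lemma3TorusTerms.weight`) and τ-parameters `lD t` = an enumeration of `𝐃`, the underintegral expression `Ψ Z t φ`
being separately holomorphic in `σ` on an open `Uσ ⊇ {|σ| ≤ e^{κ₁}}` (`κ₁ ≥ 1`) and in `τ` on an open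
`Uτ ⊇ {|τ| ≤ |τ(Y)|}` with the radii `|τ(Y)| = (invTau c (d_k Y))⁻¹` of (2.18) (`0 < invTau ≤ ½`), and bounded on the two
closed polydiscs by the Gaussian estimate `exp(−½a|P|)·exp(a₅·|Z|)` of (2.15)–(2.25) (a hypothesis: rows
B13.Eq2.15–2.25).  Then (2.26) holds for every term in the spelling of `B13Lemma3TorusTerms.hrep_of_termwise` /
`bound238_torus_of_226` (hypothesis `h226` there): `‖T Z t φ‖ ≤ weight L M c Z a t · exp(a₅·|Z|)` — by
`B13CauchyDecay.norm_term214_le_226` and the identity `2·invTau c d = α₆·ε₂·e^{−(1−3δ)κd}` (`α₆ ≠ 0`).  So on the torus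
model the hypothesis «(2.26) per term» of Lemma 3 / of the §2 chain reduces to: the (2.14)-form of the terms, separate
analyticity in the parameters, and the Gaussian sup bound. [cite: Balaban1988RG2Cluster, (2.14)–(2.15) p.15, (2.26) p.17] -/
theorem h226_torus_of_cauchy (c : B13.Consts) (hκ₁ : 1 ≤ c.κ₁) (hα₆ : c.α₆ ≠ 0) (W : TwoTorusStep d L N')
    (T : (Z : TDom d N') → Finset (TDom d (L * N')) × Finset (TBond d M (L * N')) → W.Φ → ℂ) {a a₅ : ℝ}
    {Uσ Uτ : Set ℂ} (hUσ : IsOpen Uσ) (hUτ : IsOpen Uτ) (hUexp : closedBall (0 : ℂ) (Real.exp c.κ₁) ⊆ Uσ)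
    (hUtau : ∀ Y : TDom d (L * N'), closedBall (0 : ℂ) ((invTau c ((tsys d (L * N')).dj Y))⁻¹) ⊆ Uτ)
    {r : ℝ} (hr : 0 < r) (hr' : r ≤ Real.exp c.κ₁ - 1)
    (hsubτ : ∀ s ∈ Set.uIcc (0 : ℝ) 1, closedBall (s : ℂ) r ⊆ Uτ)
    (hpos : ∀ Y : TDom d (L * N'), 0 < invTau c ((tsys d (L * N')).dj Y))
    (h2 : ∀ Y : TDom d (L * N'), invTau c ((tsys d (L * N')).dj Y) ≤ 1 / 2)
    (lZ : TDom d N' → Finset (TDom d (L * N')) × Finset (TBond d M (L * N')) → List (TPt d N'))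
    (hlZ : ∀ Z t, (lZ Z t).Nodup ∧ (lZ Z t).toFinset = Z.1 \ tclosure L N' (Z0 M t))
    (lD : Finset (TDom d (L * N')) × Finset (TBond d M (L * N')) → List (TDom d (L * N')))
    (hlD : ∀ t, (lD t).Nodup ∧ (lD t).toFinset = t.1)
    (Ψ : (Z : TDom d N') → Finset (TDom d (L * N')) × Finset (TBond d M (L * N')) → W.Φ →
      (TPt d N' → ℂ) → (TDom d (L * N') → ℂ) → ℂ)
    (hT : ∀ Z t φ, T Z t φ = term214 r (lZ Z t) (lD t) (Ψ Z t φ) 0 0)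
    (hΨσ : ∀ Z t φ, φ ∈ W.sp2 Z → ∀ τ : TDom d (L * N') → ℂ, (∀ j, τ j ∈ Uτ) →
      SepHolOn Uσ (fun σ => Ψ Z t φ σ τ))
    (hΨτ : ∀ Z t φ, φ ∈ W.sp2 Z → ∀ σ : TPt d N' → ℂ, (∀ j, σ j ∈ Uσ) →
      SepHolOn Uτ (fun τ => Ψ Z t φ σ τ))
    (hK : ∀ Z t φ, φ ∈ W.sp2 Z → ∀ (σ : TPt d N' → ℂ) (τ : TDom d (L * N') → ℂ), (∀ j, ‖σ j‖ ≤ Real.exp c.κ₁) →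
      (∀ Y, ‖τ Y‖ ≤ (invTau c ((tsys d (L * N')).dj Y))⁻¹) →
      ‖Ψ Z t φ σ τ‖ ≤ Real.exp (-(a / 2 * (t.2.card : ℝ))) * Real.exp (a₅ * ((Z.1).card : ℝ))) :
    ∀ (Z : TDom d N') (φ : W.Φ), φ ∈ W.sp2 Z → ∀ t ∈ terms L M Z,
      ‖T Z t φ‖ ≤ weight L M c Z a t * Real.exp (a₅ * ((Z.1).card : ℝ)) := by
  intro Z φ hφ t _
  rw [hT Z t φ]
  have h := norm_term214_le_226 (ι := TPt d N') (F := ℂ) c hκ₁ (fun Y : TDom d (L * N') => (tsys d (L * N')).dj Y)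
    hUσ hUτ hUexp hUtau hr hr' hsubτ (hΨσ Z t φ hφ) (hΨτ Z t φ hφ) (hK Z t φ hφ) (hlZ Z t).1 (hlD t).1 hpos h2
    (σ₀ := 0) (fun _ => by simp) (τ₀ := 0) (fun _ => by simp)
  have hlen : ((lZ Z t).length : ℝ) = ((Z.1 \ tclosure L N' (Z0 M t)).card : ℝ) := by
    rw [← List.toFinset_card_of_nodup (hlZ Z t).1, (hlZ Z t).2]
  rw [hlen, (hlD t).2] at h
  refine h.trans (le_of_eq ?_)
  simp only [weight, two_mul_invTau_eq c hα₆]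
  ring_nf

end

end Literature.MathematicalPhysics.QuantumFieldTheory.Balaban1983to89.B13Lemma3TorusCauchy
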